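import Literature.Analysis.FluidPDE.LocalHelmholtzSupBound
import Literature.Analysis.FluidPDE.OseenHeatLpBounds
import HarnessLib

/-!
# Morrey's sup bound on `ℝ³`: `sup |u| ≤ C (‖Du‖_{L^p} + ‖u‖_{L^p})` for `p > 3`

search for candidate a priori estimates; no regularity claim (cell `pub-nsfunc`, literature seat:
a published embedding as a THEOREM; nothing new).

The case `p > n` (`n = 3`) of the Sobolev imbedding theorem on the whole space, in the form
printed by Adams (*Sobolev Spaces*, 1975, Lemma 5.15 with its inequality (25), `m = 1`, `p > n`):
"`sup_{x ∈ Ω} |φ(x)| ≤ K ‖φ‖_{1,p,Ω}` for any `φ ∈ C^∞(Ω)`", `Ω = ℝ³` (which has the cone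
property), and its Corollary 5.16 "if `mp > n`, then `W^{m,p}(Ω) → L^q(Ω)` for `p ≤ q ≤ ∞`";
equivalently Gilbarg–Trudinger Theorem 7.10, case `p > n` (`sup_Ω |u| ≤ C |Ω|^{1/n−1/p} ‖Du‖_p`
for `u ∈ W^{1,p}_0(Ω)`), applied to the localisation `χφ` of `φ` to a ball of fixed radius.
We prove it for `C²` functions (the class used by the tree's classical Navier–Stokes slices)
along Gilbarg–Trudinger's potential route (§7.8):

* `eq_sum_integral_fderiv_newtonKernel_mul_fderiv` — the first-order Newtonian representation
  `ψ(y) = Σᵢ ∫ ∂ᵢΓ(y − x) ∂ᵢψ(x) dx` for `ψ ∈ C²_c(ℝ³)` (GT Lemma 7.14, (7.36) with `n ω_n = 4π`,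
  `∂ᵢΓ(z) = zᵢ/(4π|z|³)`; obtained from Green's representation `∫ Γ(y−x)Δψ(x)dx = ψ(y)`, GT
  (2.17), tree `integral_newtonKernel_mul_laplacian`, and the integration by parts
  `integral_newtonKernel_smul_fderiv_eq`, as GT remarks after (7.36));
* `enorm_le_lintegral_inv_sq_mul_fderiv` — the Riesz-potential bound
  `|ψ(y)| ≤ 3 ∫ (4π|y−x|²)⁻¹ |Dψ(x)| dx` (GT (7.37) `|u| ≤ (nω_n)⁻¹ V_{1/n}|Du|`, here with the
  cruder constant `3/(4π)` from bounding each of the three terms separately);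
* `exists_enorm_le_eLpNorm_fderiv_add_real`, `exists_enorm_le_eLpNorm_fderiv_add` — **Morrey's
  sup bound**: for `3 < p < ∞` there is `C = C(p)` with
  `|u(x)| ≤ C (‖Du‖_{L^p(ℝ³)} + ‖u‖_{L^p(ℝ³)})` for every `u ∈ C²(ℝ³; F)` and every `x`
  (localise with the tree's cutoff `suppCutoff x 1`, apply the potential bound to `χu`, and
  Hölder with exponents `p' = p/(p−1) < 3/2`, `p` against the kernel `1_{|z|≤2}(4π|z|²)⁻¹ ∈ L^{p'}`
  — GT Lemma 7.12 with `q = ∞`, `μ = 1/3`, `δ = 1/p < μ`; vector values through a norming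
  functional);
* `exists_eLpNorm_top_le_eLpNorm_fderiv_add` — the same as `‖u‖_{L^∞} ≤ C (‖Du‖_p + ‖u‖_p)`;
* `memLp_of_eLpNorm_fderiv_lt_top` — Adams's Corollary 5.16 on `ℝ³` for `m = 1`:
  `u, Du ∈ L^p`, `p > 3` ⇒ `u ∈ L^r` for every `p ≤ r ≤ ∞` (interpolation `L^p ∩ L^∞ ⊂ L^r`,
  tree `memLp_of_memLp_of_memLp_top`).

Not covered (nothing is asserted about them): the Hölder-seminorm half of Morrey's inequality
(GT Theorem 7.17), functions of class `C¹`/`W^{1,p}` rather than `C²`, dimensions `n ≠ 3`.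
-- TODO(general form): `u ∈ W^{1,p}(ℝⁿ)`, `n < p ≤ ∞`, with the `C^{0,1−n/p}` seminorm.

## Mathlib / tree search

Tree: `newtonKernel`, `norm_fderiv_newtonKernel_le`, `integral_newtonKernel_mul_laplacian`,
`integral_newtonKernel_smul_fderiv_eq` (`BiotSavartNewtonKernel`), `integrable_newtonKernel_mul`
(`NormalisedPressureL2Bound`), `laplacian_eq_sum_fderiv_fderiv` (`WholeSpaceIBP`), `suppCutoff`,
`suppCutoff_eq_one`, `suppCutoff_eq_zero`, `abs_suppCutoff_le_one`, `contDiff_suppCutoff`,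
`hasCompactSupport_suppCutoff` (`SingularKernelGradient`), `exists_norm_gradient_suppCutoff_le`,
`gradient_suppCutoff_eq_zero_of_two_lt` (`LocalHelmholtzSupBound`),
`NewtonPotentialHolder.lintegral_ball_norm_rpow_neg`, `memLp_of_memLp_of_memLp_top`
(`OseenHeatLpBounds`). Mathlib: `ENNReal.lintegral_mul_le_Lp_mul_Lq`, `lintegral_sub_left_eq_self`,
`eLpNorm_eq_lintegral_rpow_enorm_toReal`, `exists_dual_vector''`, `Real.HolderConjugate.conjExponent`;
Mathlib has the Gagliardo–Nirenberg–Sobolev inequality (`p < n`, `Mathlib.Analysis.FunctionalSpaces.SobolevInequality`)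
but no `p > n` (Morrey) embedding.

## References

* R. A. Adams, *Sobolev Spaces*, Academic Press (1975): Lemma 5.15 with (25), Corollary 5.16
  (held text: panama scan keyed `book:adams2003-sobolev-spaces-2nd-ed`, pp. 97–98 of the scan,
  printed pp. 97–98; Theorem 5.4 Part I Case C). [Adams1975]
* D. Gilbarg, N. S. Trudinger, *Elliptic partial differential equations of second order*, Springer
  (2001 reprint): Theorem 7.10 with (7.26) (case `p > n`), Lemma 7.12 (7.34), Lemma 7.14
  (7.36)–(7.37), (2.17) (held text pp. 240–244). [GilbargTrudinger2001]
-/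

noncomputable section

open MeasureTheory Set Filter Topology Function Metric
open scoped ENNReal NNReal Laplacian

namespace Literature.Analysis.FluidPDE

section Representation

/-- **First-order Newtonian representation of a `C²_c` function** (Gilbarg–Trudinger Lemma 7.14,
(7.36), `n = 3`, `nω_n = 4π`): `ψ(y) = Σᵢ ∫ ∂ᵢΓ(y − x) ∂ᵢψ(x) dx`, where `Γ = newtonKernel`
(`∂ᵢΓ(z) = zᵢ/(4π|z|³)`). From Green's representation `ψ(y) = ∫ Γ(y − x) Δψ(x) dx` (GT (2.17))
by writing `Δψ = Σᵢ ∂ᵢ∂ᵢψ` and integrating each term by parts against `Γ`. [cite: GilbargTrudinger2001, Lemma 7.14 (7.36) with (2.17) (held text p. 244)] -/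
theorem eq_sum_integral_fderiv_newtonKernel_mul_fderiv {ψ : EuclideanSpace ℝ (Fin 3) → ℝ}
    (hψ : ContDiff ℝ 2 ψ) (hc : HasCompactSupport ψ) (y : EuclideanSpace ℝ (Fin 3)) :
    ψ y = ∑ i, ∫ x, fderiv ℝ newtonKernel (y - x) (EuclideanSpace.basisFun (Fin 3) ℝ i) *
      fderiv ℝ ψ x (EuclideanSpace.basisFun (Fin 3) ℝ i) := by
  set b := EuclideanSpace.basisFun (Fin 3) ℝ with hb
  -- the first partials `∂ᵢψ ∈ C¹_c`
  have hΦ1 : ∀ i, ContDiff ℝ 1 fun x => fderiv ℝ ψ x (b i) := fun i =>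
    (hψ.fderiv_right (m := 1) le_rfl).clm_apply contDiff_const
  have hΦc : ∀ i, HasCompactSupport fun x => fderiv ℝ ψ x (b i) := fun i =>
    hc.fderiv_apply (𝕜 := ℝ) (b i)
  -- the pure second partials are continuous with compact support
  have h2c : ∀ i, Continuous fun x => fderiv ℝ (fun z => fderiv ℝ ψ z (b i)) x (b i) := fun i =>
    ((hΦ1 i).continuous_fderiv one_ne_zero).clm_apply continuous_const
  have h2s : ∀ i, HasCompactSupport fun x => fderiv ℝ (fun z => fderiv ℝ ψ z (b i)) x (b i) :=
    fun i => (hΦc i).fderiv_apply (𝕜 := ℝ) (b i)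
  calc ψ y = ∫ x, newtonKernel (y - x) * (Δ ψ) x :=
        (integral_newtonKernel_mul_laplacian hψ hc y).symm
    _ = ∫ x, ∑ i, newtonKernel (y - x) * fderiv ℝ (fun z => fderiv ℝ ψ z (b i)) x (b i) := by
        congr 1
        funext x
        rw [laplacian_eq_sum_fderiv_fderiv b hψ x, Finset.mul_sum]
    _ = ∑ i, ∫ x, newtonKernel (y - x) * fderiv ℝ (fun z => fderiv ℝ ψ z (b i)) x (b i) :=
        integral_finsetSum _ fun i _ => integrable_newtonKernel_mul (h2c i) (h2s i) y
    _ = ∑ i, ∫ x, fderiv ℝ newtonKernel (y - x) (b i) * fderiv ℝ ψ x (b i) := by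
        refine Finset.sum_congr rfl fun i _ => ?_
        have h := integral_newtonKernel_smul_fderiv_eq (F := ℝ) (hΦ1 i) (hΦc i) y (b i)
        simpa only [smul_eq_mul] using h

/-- **The Riesz-potential bound for `C²_c` functions on `ℝ³`** (Gilbarg–Trudinger (7.37),
`|u| ≤ (nω_n)⁻¹ V_{1/n}|Du|`, here with the cruder constant `3/(4π)` in place of `1/(4π)`):
`|ψ(y)| ≤ 3 ∫ (4π|y − x|²)⁻¹ |Dψ(x)| dx` for `ψ ∈ C²_c(ℝ³)`, written with the lower Lebesgue
integral (each of the three terms of the representation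
`eq_sum_integral_fderiv_newtonKernel_mul_fderiv` is bounded through `|∂ᵢΓ(z)| ≤ (4π|z|²)⁻¹`,
tree `norm_fderiv_newtonKernel_le`). [cite: GilbargTrudinger2001, Lemma 7.14 (7.37) (held text p. 244)] -/
theorem enorm_le_lintegral_inv_sq_mul_fderiv {ψ : EuclideanSpace ℝ (Fin 3) → ℝ}
    (hψ : ContDiff ℝ 2 ψ) (hc : HasCompactSupport ψ) (y : EuclideanSpace ℝ (Fin 3)) :
    ‖ψ y‖ₑ ≤ 3 * ∫⁻ x, ENNReal.ofReal ((4 * Real.pi * ‖y - x‖ ^ 2)⁻¹) * ‖fderiv ℝ ψ x‖ₑ := by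
  set b := EuclideanSpace.basisFun (Fin 3) ℝ with hb
  set J : ℝ≥0∞ := ∫⁻ x, ENNReal.ofReal ((4 * Real.pi * ‖y - x‖ ^ 2)⁻¹) * ‖fderiv ℝ ψ x‖ₑ
    with hJ
  have hterm : ∀ i, ‖∫ x, fderiv ℝ newtonKernel (y - x) (b i) * fderiv ℝ ψ x (b i)‖ₑ ≤ J := by
    intro i
    refine (enorm_integral_le_lintegral_enorm _).trans (lintegral_mono fun x => ?_)
    rw [enorm_mul]
    gcongr
    · rw [← ofReal_norm]
      refine ENNReal.ofReal_le_ofReal ?_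
      calc ‖fderiv ℝ newtonKernel (y - x) (b i)‖
          ≤ ‖fderiv ℝ newtonKernel (y - x)‖ * ‖b i‖ := ContinuousLinearMap.le_opNorm _ _
        _ = ‖fderiv ℝ newtonKernel (y - x)‖ := by rw [b.norm_eq_one, mul_one]
        _ ≤ (4 * Real.pi * ‖y - x‖ ^ 2)⁻¹ := norm_fderiv_newtonKernel_le _
    · rw [← ofReal_norm, ← ofReal_norm]
      refine ENNReal.ofReal_le_ofReal ?_
      calc ‖fderiv ℝ ψ x (b i)‖ ≤ ‖fderiv ℝ ψ x‖ * ‖b i‖ := ContinuousLinearMap.le_opNorm _ _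
        _ = ‖fderiv ℝ ψ x‖ := by rw [b.norm_eq_one, mul_one]
  calc ‖ψ y‖ₑ = ‖∑ i, ∫ x, fderiv ℝ newtonKernel (y - x) (b i) * fderiv ℝ ψ x (b i)‖ₑ := by
        rw [← eq_sum_integral_fderiv_newtonKernel_mul_fderiv hψ hc y]
    _ ≤ ∑ i, ‖∫ x, fderiv ℝ newtonKernel (y - x) (b i) * fderiv ℝ ψ x (b i)‖ₑ :=
        enorm_sum_le _ _
    _ ≤ ∑ _i : Fin 3, J := Finset.sum_le_sum fun i _ => hterm i
    _ = 3 * J := by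
        rw [Finset.sum_const, Finset.card_univ, Fintype.card_fin, nsmul_eq_mul, Nat.cast_ofNat]

end Representation

section Morrey

/-- The norm of the gradient is the norm of the Fréchet derivative. [folklore] -/
private theorem norm_gradient_eq' {f : EuclideanSpace ℝ (Fin 3) → ℝ} (x : EuclideanSpace ℝ (Fin 3)) :
    ‖gradient f x‖ = ‖fderiv ℝ f x‖ := by
  unfold gradient
  exact (InnerProductSpace.toDual ℝ (EuclideanSpace ℝ (Fin 3))).symm.norm_map _

/-- The truncated Riesz kernel `k(z) = 1_{|z| ≤ 2} (4π|z|²)⁻¹` lies in `L^{p'}(ℝ³)` for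
`2p' < 3`: `∫ k^{p'} < ∞` (comparison with `∫_{|z|<3} |z|^{-2p'} dz < ∞`, tree
`NewtonPotentialHolder.lintegral_ball_norm_rpow_neg`). This is Gilbarg–Trudinger's
`h = |x−y|^{n(μ−1)} ∈ L^r` step in the proof of Lemma 7.12. [cite: GilbargTrudinger2001, Lemma 7.12 proof (held text p. 243)] -/
theorem lintegral_indicator_inv_sq_rpow_lt_top {s : ℝ} (hs0 : 0 < s) (hs : 2 * s < 3) :
    ∫⁻ z : EuclideanSpace ℝ (Fin 3), (closedBall (0 : EuclideanSpace ℝ (Fin 3)) 2).indicator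
        (fun z => ENNReal.ofReal ((4 * Real.pi * ‖z‖ ^ 2)⁻¹)) z ^ s < ⊤ := by
  have hπ : 0 < 4 * Real.pi := by positivity
  -- pointwise comparison with `(4π)^{-s} |z|^{-2s}` on the ball of radius `3`
  have hpt : ∀ z : EuclideanSpace ℝ (Fin 3),
      (closedBall (0 : EuclideanSpace ℝ (Fin 3)) 2).indicator
          (fun z => ENNReal.ofReal ((4 * Real.pi * ‖z‖ ^ 2)⁻¹)) z ^ s ≤
        ENNReal.ofReal ((4 * Real.pi)⁻¹ ^ s) *
          (ball (0 : EuclideanSpace ℝ (Fin 3)) 3).indicator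
            (fun z => ENNReal.ofReal (‖z‖ ^ (-(2 * s)))) z := by
    intro z
    by_cases hz : z ∈ closedBall (0 : EuclideanSpace ℝ (Fin 3)) 2
    · have hz3 : z ∈ ball (0 : EuclideanSpace ℝ (Fin 3)) 3 := by
        rw [mem_closedBall_zero_iff] at hz
        rw [mem_ball_zero_iff]
        linarith
      rw [indicator_of_mem hz, indicator_of_mem hz3]
      rcases eq_or_ne z 0 with rfl | hz0
      · rw [norm_zero, zero_pow two_ne_zero, mul_zero, inv_zero, ENNReal.ofReal_zero,
          ENNReal.zero_rpow_of_pos hs0]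
        exact bot_le
      · have hn : 0 < ‖z‖ := norm_pos_iff.2 hz0
        rw [ENNReal.ofReal_rpow_of_nonneg (by positivity) hs0.le, ← ENNReal.ofReal_mul
          (by positivity)]
        refine ENNReal.ofReal_le_ofReal (le_of_eq ?_)
        rw [mul_inv, Real.mul_rpow (by positivity) (by positivity), ← Real.rpow_natCast,
          Nat.cast_ofNat, ← Real.rpow_neg hn.le, ← Real.rpow_mul hn.le]
        congr 1
        ring_nf
    · rw [indicator_of_notMem hz, ENNReal.zero_rpow_of_pos hs0]
      exact bot_le
  refine lt_of_le_of_lt (lintegral_mono hpt) ?_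
  rw [lintegral_const_mul' _ _ ENNReal.ofReal_ne_top, lintegral_indicator measurableSet_ball,
    NewtonPotentialHolder.lintegral_ball_norm_rpow_neg hs (by norm_num : (0 : ℝ) < 3)]
  exact ENNReal.mul_lt_top ENNReal.ofReal_lt_top ENNReal.ofReal_lt_top

/-- **Morrey's sup bound on `ℝ³`, real-valued functions** (Adams 1975, Lemma 5.15, inequality
(25) with `m = 1`, `p > n = 3`, `Ω = ℝ³`: "`sup_{x∈Ω} |φ(x)| ≤ K ‖φ‖_{1,p,Ω}`";
Gilbarg–Trudinger Theorem 7.10, case `p > n`, applied to the localisation `χφ`): for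
`3 < p < ∞` there is `C = C(p)` such that every `φ ∈ C²(ℝ³; ℝ)` satisfies
`|φ(x)| ≤ C (‖Dφ‖_{L^p(ℝ³)} + ‖φ‖_{L^p(ℝ³)})` at every point `x` (both norms may be infinite).
Proof: with the tree's cutoff `χ = suppCutoff x 1` (`= 1` on `B̄(x,1)`, supported in `B̄(x,2)`,
`|∇χ| ≤ B`), `φ(x) = (χφ)(x)`, the potential bound `enorm_le_lintegral_inv_sq_mul_fderiv` for
`χφ ∈ C²_c`, `|D(χφ)| ≤ 1_{B̄(x,2)}(|Dφ| + B|φ|)`, and Hölder's inequality with the exponents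
`p' = p/(p−1)`, `p` against the kernel `1_{|z|≤2}(4π|z|²)⁻¹ ∈ L^{p'}` (`2p' < 3 ⇔ p > 3`;
GT Lemma 7.12 with `q = ∞`, `μ = 1/n`). Stated for `C²` (not `C¹`/`W^{1,p}`) functions. [cite: Adams1975, Lemma 5.15 (25) and Theorem 5.4 Part I Case C (scan pp. 89, 97–98); GilbargTrudinger2001, Theorem 7.10 (7.26) case p > n, Lemma 7.12 (7.34) (held text pp. 240–243)] -/
theorem exists_enorm_le_eLpNorm_fderiv_add_real {p : ℝ≥0∞} (hp : 3 < p) (hp' : p < ⊤) :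
    ∃ C : ℝ≥0, ∀ φ : EuclideanSpace ℝ (Fin 3) → ℝ, ContDiff ℝ 2 φ →
      ∀ x : EuclideanSpace ℝ (Fin 3),
        ‖φ x‖ₑ ≤ C * (eLpNorm (fderiv ℝ φ) p volume + eLpNorm φ p volume) := by
  -- exponents: `q = p.toReal > 3`, `q' = q/(q-1)`, `2q' < 3`
  have hp0 : p ≠ 0 := (lt_trans (by norm_num) hp).ne'
  have hptop : p ≠ ⊤ := hp'.ne
  set q : ℝ := p.toReal with hq
  have h3q : 3 < q := by
    have h := (ENNReal.toReal_lt_toReal (by norm_num : (3 : ℝ≥0∞) ≠ ⊤) hptop).2 hp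
    simpa using h
  have h1q : 1 < q := by linarith
  set q' : ℝ := q.conjExponent with hq'def
  have hqq' : q'.HolderConjugate q := (Real.HolderConjugate.conjExponent h1q).symm
  have hq'pos : 0 < q' := hqq'.pos
  have hq'eq : q' = q / (q - 1) := rfl
  have hq'lt : 2 * q' < 3 := by
    rw [hq'eq, mul_div_assoc', div_lt_iff₀ (by linarith)]
    linarith
  -- the kernel `k = 1_{|z|≤2} (4π|z|²)⁻¹` and its `L^{q'}` norm `A`
  set k : EuclideanSpace ℝ (Fin 3) → ℝ≥0∞ := fun z =>
    (closedBall (0 : EuclideanSpace ℝ (Fin 3)) 2).indicator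
      (fun z => ENNReal.ofReal ((4 * Real.pi * ‖z‖ ^ 2)⁻¹)) z with hk
  have hk_meas : Measurable k := by
    refine Measurable.indicator ?_ measurableSet_closedBall
    exact ENNReal.measurable_ofReal.comp
      ((continuous_const.mul (continuous_norm.pow 2)).measurable.inv)
  have hA : (∫⁻ z, k z ^ q') < ⊤ := lintegral_indicator_inv_sq_rpow_lt_top hq'pos hq'lt
  have hA' : (∫⁻ z, k z ^ q') ^ (1 / q') < ⊤ :=
    ENNReal.rpow_lt_top_of_nonneg (by positivity) hA.ne
  set A₁ : ℝ≥0 := ((∫⁻ z, k z ^ q') ^ (1 / q')).toNNReal with hA₁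
  have hA₁ : ((A₁ : ℝ≥0) : ℝ≥0∞) = (∫⁻ z, k z ^ q') ^ (1 / q') := ENNReal.coe_toNNReal hA'.ne
  -- the cutoff gradient bound
  obtain ⟨B, hB0, hB⟩ := exists_norm_gradient_suppCutoff_le
  set B₁ : ℝ≥0 := B.toNNReal with hB₁
  have hBB₁ : ENNReal.ofReal B = (B₁ : ℝ≥0∞) := rfl
  refine ⟨3 * A₁ * (1 + B₁), fun φ hφ x => ?_⟩
  have hφd : Differentiable ℝ φ := hφ.differentiable (by simp)
  have hφc : Continuous φ := hφ.continuous
  have hDφc : Continuous (fderiv ℝ φ) := hφ.continuous_fderiv (by simp)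
  -- the localisation `ψ = χ φ`
  set χ : EuclideanSpace ℝ (Fin 3) → ℝ := suppCutoff x 1 with hχ
  have hχ2 : ContDiff ℝ 2 χ := contDiff_suppCutoff x 1
  have hχd : Differentiable ℝ χ := hχ2.differentiable (by simp)
  have hχc : HasCompactSupport χ := hasCompactSupport_suppCutoff x one_pos
  set ψ : EuclideanSpace ℝ (Fin 3) → ℝ := fun t => χ t * φ t with hψ
  have hψ2 : ContDiff ℝ 2 ψ := hχ2.mul hφ
  have hψc : HasCompactSupport ψ := hχc.mul_right
  have hψx : ψ x = φ x := by
    simp only [hψ, hχ]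
    rw [suppCutoff_eq_one one_pos (by rw [sub_self, norm_zero]; norm_num), one_mul]
  -- the derivative of `ψ` and its bound `|Dψ(t)| ≤ 1_{|t-x|≤2} (|Dφ(t)| + B|φ(t)|)`
  have hDψ : ∀ t, fderiv ℝ ψ t = χ t • fderiv ℝ φ t + φ t • fderiv ℝ χ t := fun t =>
    fderiv_fun_mul (hχd t) (hφd t)
  have hpt : ∀ t, ENNReal.ofReal ((4 * Real.pi * ‖x - t‖ ^ 2)⁻¹) * ‖fderiv ℝ ψ t‖ₑ ≤
      k (x - t) * (‖fderiv ℝ φ t‖ₑ + ENNReal.ofReal B * ‖φ t‖ₑ) := by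
    intro t
    by_cases ht : ‖t - x‖ ≤ 2
    · have hmem : x - t ∈ closedBall (0 : EuclideanSpace ℝ (Fin 3)) 2 := by
        rw [mem_closedBall_zero_iff, norm_sub_rev]; exact ht
      have hkt : k (x - t) = ENNReal.ofReal ((4 * Real.pi * ‖x - t‖ ^ 2)⁻¹) := by
        simp only [hk, indicator_of_mem hmem]
      rw [hkt]
      gcongr
      -- `‖Dψ t‖ ≤ ‖Dφ t‖ + B |φ t|`
      have h1 : ‖fderiv ℝ ψ t‖ ≤ ‖fderiv ℝ φ t‖ + B * |φ t| := by
        rw [hDψ t]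
        calc ‖χ t • fderiv ℝ φ t + φ t • fderiv ℝ χ t‖
            ≤ ‖χ t • fderiv ℝ φ t‖ + ‖φ t • fderiv ℝ χ t‖ := norm_add_le _ _
          _ = |χ t| * ‖fderiv ℝ φ t‖ + |φ t| * ‖fderiv ℝ χ t‖ := by
              rw [norm_smul, norm_smul, Real.norm_eq_abs, Real.norm_eq_abs]
          _ ≤ 1 * ‖fderiv ℝ φ t‖ + |φ t| * B := by
              gcongr
              · exact abs_suppCutoff_le_one x 1 t
              · rw [← norm_gradient_eq']; exact hB x t
          _ = ‖fderiv ℝ φ t‖ + B * |φ t| := by ring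
      calc ‖fderiv ℝ ψ t‖ₑ = ENNReal.ofReal ‖fderiv ℝ ψ t‖ := (ofReal_norm _).symm
        _ ≤ ENNReal.ofReal (‖fderiv ℝ φ t‖ + B * |φ t|) := ENNReal.ofReal_le_ofReal h1
        _ = ‖fderiv ℝ φ t‖ₑ + ENNReal.ofReal B * ‖φ t‖ₑ := by
            rw [ENNReal.ofReal_add (norm_nonneg _) (by positivity), ofReal_norm,
              ENNReal.ofReal_mul hB0, Real.enorm_eq_ofReal_abs]
    · -- off `B̄(x,2)`: `χ t = 0`, `Dχ t = 0`, so `Dψ t = 0`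
      rw [not_le] at ht
      have hχ0 : χ t = 0 := suppCutoff_eq_zero one_pos (by linarith)
      have hDχ0 : fderiv ℝ χ t = 0 := by
        have h := gradient_suppCutoff_eq_zero_of_two_lt (x := x) (y := t) ht
        rw [gradient] at h
        simpa using h
      have hDψ0 : fderiv ℝ ψ t = 0 := by
        rw [hDψ t, hχ0, hDχ0, zero_smul, smul_zero, add_zero]
      rw [← ofReal_norm, hDψ0, ContinuousLinearMap.opNorm_zero, ENNReal.ofReal_zero, mul_zero]
      exact bot_le
  -- measurability of the three integrands
  have hk_sub : Measurable fun t : EuclideanSpace ℝ (Fin 3) => k (x - t) :=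
    hk_meas.comp (measurable_id.const_sub x)
  have hDφ_meas : Measurable fun t => ‖fderiv ℝ φ t‖ₑ := hDφc.measurable.enorm
  have hφ_meas : Measurable fun t => ‖φ t‖ₑ := hφc.measurable.enorm
  -- Hölder against the kernel: `∫ k(x-t) g(t) dt ≤ A₁ ‖g‖_p`
  have holder : ∀ g : EuclideanSpace ℝ (Fin 3) → ℝ≥0∞, Measurable g →
      ∫⁻ t, k (x - t) * g t ≤ (A₁ : ℝ≥0∞) * (∫⁻ t, g t ^ q) ^ (1 / q) := by
    intro g hg
    have h := ENNReal.lintegral_mul_le_Lp_mul_Lq volume hqq' hk_sub.aemeasurable hg.aemeasurable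
    refine h.trans (le_of_eq ?_)
    rw [hA₁]
    congr 2
    exact lintegral_sub_left_eq_self (fun z => k z ^ q') x
  have hnormD : (∫⁻ t, ‖fderiv ℝ φ t‖ₑ ^ q) ^ (1 / q) = eLpNorm (fderiv ℝ φ) p volume :=
    (eLpNorm_eq_lintegral_rpow_enorm_toReal hp0 hptop).symm
  have hnorm0 : (∫⁻ t, ‖φ t‖ₑ ^ q) ^ (1 / q) = eLpNorm φ p volume :=
    (eLpNorm_eq_lintegral_rpow_enorm_toReal hp0 hptop).symm
  -- assemble
  calc ‖φ x‖ₑ = ‖ψ x‖ₑ := by rw [hψx]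
    _ ≤ 3 * ∫⁻ t, ENNReal.ofReal ((4 * Real.pi * ‖x - t‖ ^ 2)⁻¹) * ‖fderiv ℝ ψ t‖ₑ :=
        enorm_le_lintegral_inv_sq_mul_fderiv hψ2 hψc x
    _ ≤ 3 * ∫⁻ t, k (x - t) * (‖fderiv ℝ φ t‖ₑ + ENNReal.ofReal B * ‖φ t‖ₑ) := by
        gcongr 3 * ?_
        exact lintegral_mono hpt
    _ = 3 * ((∫⁻ t, k (x - t) * ‖fderiv ℝ φ t‖ₑ) +
          ENNReal.ofReal B * ∫⁻ t, k (x - t) * ‖φ t‖ₑ) := by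
        congr 1
        have hm1 : Measurable fun t => k (x - t) * ‖fderiv ℝ φ t‖ₑ := hk_sub.mul hDφ_meas
        have hm2 : Measurable fun t => k (x - t) * ‖φ t‖ₑ := hk_sub.mul hφ_meas
        calc ∫⁻ t, k (x - t) * (‖fderiv ℝ φ t‖ₑ + ENNReal.ofReal B * ‖φ t‖ₑ)
            = ∫⁻ t, (k (x - t) * ‖fderiv ℝ φ t‖ₑ + ENNReal.ofReal B * (k (x - t) * ‖φ t‖ₑ)) :=
              lintegral_congr fun t => by ring
          _ = (∫⁻ t, k (x - t) * ‖fderiv ℝ φ t‖ₑ) +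
                ∫⁻ t, ENNReal.ofReal B * (k (x - t) * ‖φ t‖ₑ) := lintegral_add_left hm1 _
          _ = (∫⁻ t, k (x - t) * ‖fderiv ℝ φ t‖ₑ) +
                ENNReal.ofReal B * ∫⁻ t, k (x - t) * ‖φ t‖ₑ := by
              rw [lintegral_const_mul _ hm2]
    _ ≤ 3 * ((A₁ : ℝ≥0∞) * eLpNorm (fderiv ℝ φ) p volume +
          ENNReal.ofReal B * ((A₁ : ℝ≥0∞) * eLpNorm φ p volume)) := by
        rw [← hnormD, ← hnorm0]
        gcongr
        · exact holder _ hDφ_meas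
        · exact holder _ hφ_meas
    _ ≤ ((3 * A₁ * (1 + B₁) : ℝ≥0) : ℝ≥0∞) *
          (eLpNorm (fderiv ℝ φ) p volume + eLpNorm φ p volume) := by
        rw [hBB₁]
        push_cast
        set X := eLpNorm (fderiv ℝ φ) p volume
        set Y := eLpNorm φ p volume
        calc 3 * ((A₁ : ℝ≥0∞) * X + (B₁ : ℝ≥0∞) * ((A₁ : ℝ≥0∞) * Y))
            = 3 * (A₁ : ℝ≥0∞) * 1 * X + 3 * (A₁ : ℝ≥0∞) * (B₁ : ℝ≥0∞) * Y := by ring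
          _ ≤ 3 * (A₁ : ℝ≥0∞) * (1 + (B₁ : ℝ≥0∞)) * X +
              3 * (A₁ : ℝ≥0∞) * (1 + (B₁ : ℝ≥0∞)) * Y := by
              gcongr
              · exact le_self_add
              · exact le_add_self
          _ = 3 * (A₁ : ℝ≥0∞) * (1 + (B₁ : ℝ≥0∞)) * (X + Y) := by ring

variable {F : Type*} [NormedAddCommGroup F] [NormedSpace ℝ F]

/-- **Morrey's sup bound on `ℝ³`** (Adams 1975, Lemma 5.15 (25) / Theorem 5.4 Part I Case C
with `m = 1`, `p > n = 3`, `Ω = ℝ³`; Gilbarg–Trudinger Theorem 7.10, case `p > n`): for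
`3 < p < ∞` there is `C = C(p)` such that every `u ∈ C²(ℝ³; F)` (`F` any real normed space)
satisfies `‖u(x)‖ ≤ C (‖Du‖_{L^p(ℝ³)} + ‖u‖_{L^p(ℝ³)})` at every `x`. Reduced to the real case
`exists_enorm_le_eLpNorm_fderiv_add_real` through a norming functional `g`, `‖g‖ ≤ 1`,
`g(u(x)) = ‖u(x)‖` (`|g ∘ u| ≤ ‖u‖`, `‖D(g ∘ u)‖ ≤ ‖Du‖`). Stated for `C²` functions. [cite: Adams1975, Lemma 5.15 (25) and Theorem 5.4 Part I Case C (scan pp. 89, 97–98); GilbargTrudinger2001, Theorem 7.10 (7.26) case p > n (held text p. 240)] -/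
theorem exists_enorm_le_eLpNorm_fderiv_add {p : ℝ≥0∞} (hp : 3 < p) (hp' : p < ⊤) :
    ∃ C : ℝ≥0, ∀ u : EuclideanSpace ℝ (Fin 3) → F, ContDiff ℝ 2 u →
      ∀ x : EuclideanSpace ℝ (Fin 3),
        ‖u x‖ₑ ≤ C * (eLpNorm (fderiv ℝ u) p volume + eLpNorm u p volume) := by
  obtain ⟨C, hC⟩ := exists_enorm_le_eLpNorm_fderiv_add_real hp hp'
  refine ⟨C, fun u hu x => ?_⟩
  obtain ⟨g, hg1, hgx⟩ := exists_dual_vector'' ℝ (u x)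
  have hgx' : g (u x) = ‖u x‖ := by simpa using hgx
  set φ : EuclideanSpace ℝ (Fin 3) → ℝ := fun t => g (u t) with hφ
  have hφ2 : ContDiff ℝ 2 φ := g.contDiff.comp hu
  have hud : Differentiable ℝ u := hu.differentiable (by simp)
  -- pointwise comparisons `|φ| ≤ ‖u‖`, `‖Dφ‖ ≤ ‖Du‖`
  have h0 : ∀ t, ‖φ t‖ ≤ ‖u t‖ := fun t =>
    (g.le_opNorm _).trans (mul_le_of_le_one_left (norm_nonneg _) hg1)
  have h1 : ∀ t, ‖fderiv ℝ φ t‖ ≤ ‖fderiv ℝ u t‖ := fun t => by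
    have hd : fderiv ℝ φ t = g.comp (fderiv ℝ u t) := by
      show fderiv ℝ (⇑g ∘ u) t = _
      rw [fderiv_comp t g.differentiableAt (hud t), ContinuousLinearMap.fderiv]
    rw [hd]
    exact (ContinuousLinearMap.opNorm_comp_le _ _).trans
      (mul_le_of_le_one_left (norm_nonneg _) hg1)
  calc ‖u x‖ₑ = ‖φ x‖ₑ := by
        rw [hφ]
        simp only [hgx']
        rw [← ofReal_norm, ← ofReal_norm, norm_norm]
    _ ≤ C * (eLpNorm (fderiv ℝ φ) p volume + eLpNorm φ p volume) := hC φ hφ2 x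
    _ ≤ C * (eLpNorm (fderiv ℝ u) p volume + eLpNorm u p volume) := by
        gcongr
        · exact eLpNorm_mono h1
        · exact eLpNorm_mono h0

/-- **Morrey's sup bound, `L^∞` form** (Adams 1975, Lemma 5.15; Gilbarg–Trudinger Theorem 7.10,
case `p > n`): for `3 < p < ∞` there is `C = C(p)` with
`‖u‖_{L^∞(ℝ³)} ≤ C (‖Du‖_{L^p(ℝ³)} + ‖u‖_{L^p(ℝ³)})` and the pointwise bound at every `x`, for all
`u ∈ C²(ℝ³; F)`. [cite: Adams1975, Lemma 5.15 (25) (scan pp. 97–98); GilbargTrudinger2001, Theorem 7.10 (7.26) case p > n (held text p. 240)] -/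
theorem exists_eLpNorm_top_le_eLpNorm_fderiv_add {p : ℝ≥0∞} (hp : 3 < p) (hp' : p < ⊤) :
    ∃ C : ℝ≥0, ∀ u : EuclideanSpace ℝ (Fin 3) → F, ContDiff ℝ 2 u →
      eLpNorm u ⊤ volume ≤ C * (eLpNorm (fderiv ℝ u) p volume + eLpNorm u p volume) ∧
        ∀ x : EuclideanSpace ℝ (Fin 3),
          ‖u x‖ₑ ≤ C * (eLpNorm (fderiv ℝ u) p volume + eLpNorm u p volume) := by
  obtain ⟨C, hC⟩ := exists_enorm_le_eLpNorm_fderiv_add (F := F) hp hp'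
  refine ⟨C, fun u hu => ⟨?_, hC u hu⟩⟩
  rw [eLpNorm_exponent_top]
  exact eLpNormEssSup_le_of_ae_enorm_bound (Eventually.of_forall (hC u hu))

/-- **`W^{1,p}(ℝ³) → L^r(ℝ³)` for `p > 3`, `p ≤ r ≤ ∞`** (Adams 1975, Corollary 5.16 with
`m = 1`: "if `mp > n`, then `W^{m,p}(Ω) → L^q(Ω)` for `p ≤ q ≤ ∞`"), for `C²` functions:
if `u ∈ C²(ℝ³; F)` has `‖u‖_{L^p} < ∞` and `‖Du‖_{L^p} < ∞` with `3 < p < ∞`, then `u ∈ L^r`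
for every `r ≥ p` (Morrey's bound gives `u ∈ L^∞`, then `L^p ∩ L^∞ ⊂ L^r`, tree
`memLp_of_memLp_of_memLp_top`). [cite: Adams1975, Corollary 5.16 (scan p. 98)] -/
theorem memLp_of_eLpNorm_fderiv_lt_top {p r : ℝ≥0∞} (hp : 3 < p) (hp' : p < ⊤) (hpr : p ≤ r)
    {u : EuclideanSpace ℝ (Fin 3) → F} (hu : ContDiff ℝ 2 u) (hup : eLpNorm u p volume < ⊤)
    (hDu : eLpNorm (fderiv ℝ u) p volume < ⊤) : MemLp u r volume := by
  obtain ⟨C, hC⟩ := exists_eLpNorm_top_le_eLpNorm_fderiv_add (F := F) hp hp'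
  have hmeas : AEStronglyMeasurable u volume := hu.continuous.aestronglyMeasurable
  have htop : MemLp u ⊤ volume := by
    refine ⟨hmeas, lt_of_le_of_lt (hC u hu).1 ?_⟩
    exact ENNReal.mul_lt_top ENNReal.coe_lt_top (ENNReal.add_lt_top.2 ⟨hDu, hup⟩)
  exact memLp_of_memLp_of_memLp_top (le_trans (by norm_num) hp.le) hpr ⟨hmeas, hup⟩ htop

end Morrey

end Literature.Analysis.FluidPDE
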